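/-
Copyright (c) 2026 the pub-hodgecm-mathlib formalisation cell (harness21).  Prover seat hodgecm-mathlib-K2E4-p07 (g4) (road (d-w) of ‹J3› v2, owner K2E3-p03 (g3);
(C2b-i) «TOP INDEX», FILE B1): unit classes against additive classes in a RING, and the coordinate boxes of the wild quaternion order.  2026-09-04.
-/
import Summits.HodgeConjecture.HodgeConjecture.Theorems.K2E3WildQuaternionOrder        -- ★ FILE A p857178 (this seat): `coords_of_v_norm_sub_mul_norm_le`, `v_norm_sub_mul_norm_le_of_coords` (the boxes)
import Summits.HodgeConjecture.HodgeConjecture.Theorems.K2E5BetaLieVolFactorization   -- ★ (K2E5-p06): `relIndex_prod_prod`, `relIndex_eq_mul_of_map_eq_prod` (indices of product boxes)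
import Literature.NumberTheory.Automorphic.SubgroupIndexDevissage                   -- ★ `relIndex_leAddSubgroup_exp` (`[B(exp a) : B(exp b)] = q^{a−b}`)
import HarnessLib

/-!
# K2 ∕ E3, road (d-w) — (C2b-i) FILE B1 `K2E3WildQuaternionUnitClasses`: (i) unit classes against additive classes in any ring; (ii) the coordinate boxes of the wild quaternion order and their indices

Cell `hodgecm-mathlib` (Track B «K2-LIT»), item h413 = `stmt-HodgeConjecture-24833`; PROOF lane (theorems only, no `def`∕`instance`∕`notation`∕`sorry`), `--supports stmt-HodgeConjecture-24833 --as helper`; count-neutral.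
TARGET of the series ((C2b-i), K2E5-p07 (g3)'s cand `sig_K2E3WildAnisoTopIndex` = the (C2) closer ★ p857155's `hTop`): `[S : S ∩ K_an] = (q+1)·q^{d−2}` at a wild ramified place.  Road: FILE A (★ p857178, the
order `𝒪` in coordinates) → THIS FILE → FILE B2 (the unit index `[𝒪^× : Λ^×]` and `[D¹ : Λ¹]`) → FILE C (CM dress).
* §1 **`relIndex_add_relIndex_eq_of_units_ring`** — ★ `RamifiedQuadraticResidueCountsUnits.relIndex_add_relIndex_eq_of_units` (a FIELD `K`, `Kˣ`) re-run for an arbitrary ring `R` and `Rˣ`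
  (the proof only uses `u⁻¹·C = C`-type bookkeeping): additive subgroups `C ≤ A′ ≤ A` of `R` with `[A : C] < ∞`, a subgroup `U ≤ Rˣ` whose underlying set is `A ∖ A′` and stabilises `C`, `U_C = {u ∈ U | u − 1 ∈ C}`:
  `[U : U_C] + [A′ : A′ ∩ C] = [A : C]`.  Used in FILE B2 with `R = M₂(E)`, `A = 𝒪`, `A′ = 𝔓`, `C = 𝔓^{d−1}` and with `A = Λ`, `A′ = Λ ∩ 𝔓`; + `exists_levelSubgroup` (`U_C` is a subgroup).
* §2 **THE BOXES**: `Φ(c, b) = q(c − b e₀, b)` (additive, injective; `e₀` a unit with `|N e₀ − ξ| ≤ |ϖ|^{2(d−1)}`), `Box n = B(exp n) × B(exp(n + d − 1))`; ★ FILE A ⇒ **`mem_map_box_iff`**: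
  `M ∈ Φ(Box n) ⟺ M = q(a,b)` with `|N a − ξ N b| ≤ exp(2n)` (so `Φ(Box 0) = 𝒪`, `Φ(Box(−n)) = 𝔓ⁿ`), `mem_map_intBox_iff` (`Φ(B(1) × B(1)) = Λ`), and the indices `[Φ(Box m) : Φ(Box n)] = q^{2(m−n)}`,
  `[Φ(B(exp a) × B(1)) : Φ(B(exp b) × B(1))] = q^{a−b}` (★ `relIndex_eq_mul_of_map_eq_prod`, ★ `relIndex_leAddSubgroup_exp`).
[cite: Serre1979, Ch. IV §2 Prop. 6; Ch. V §3] [cite: VignerasLNM800, Ch. II §1, §4]  HONEST LABEL: HC_CM is proved only modulo the 7 printed citations (2 remaining named inputs: hLiu418 =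
stmt-HodgeConjecture-24832, h413 = stmt-HodgeConjecture-24833) until rung 0 closes; (C2b-i) NOT proved here; count-neutral.

## References
* [Serre1979] J.-P. Serre, *Local Fields*, GTM 67 (1979) — Ch. IV §2 Prop. 6 (unit filtrations), Ch. V §3.  * [VignerasLNM800] M.-F. Vignéras, LNM 800 (1980) — Ch. II §1, §4.
-/

set_option autoImplicit false
set_option linter.dupNamespace false

noncomputable section

namespace Summit.HodgeConjecture.HodgeConjecture.Cruxes.H413.K2E3WildQuaternionUnitClasses

open WithZero
open scoped Valued Matrix
open Literature.NumberTheory.Automorphic Literature.NumberTheory.Automorphic.UnitaryGroup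
open Literature.NumberTheory.Automorphic.UnitaryThreeFourFrame (IsRamifiedQuadraticDatum)
open Literature.NumberTheory.LocalFields.WildQuadraticDatum
open Summit.HodgeConjecture.HodgeConjecture.Cruxes.H413.K2E3WildQuaternionOrder
open Summit.HodgeConjecture.HodgeConjecture.Cruxes.H413.K2E5BetaLieVolFactorization (relIndex_eq_mul_of_map_eq_prod)

/-! ## §1 Unit classes against additive classes in a ring -/

section Ring

variable {R : Type*} [Ring R]

/-- **`U_C = {u ∈ U | u − 1 ∈ C}` IS A SUBGROUP** when `U` stabilises the additive subgroup `C` (`u·C ⊆ C` for `u ∈ U`). [cite: Serre1979, Ch. IV §2 Prop. 6] -/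
theorem exists_levelSubgroup (C : AddSubgroup R) (U : Subgroup Rˣ) (hUC : ∀ u : Rˣ, u ∈ U → ∀ x : R, x ∈ C → (u : R) * x ∈ C) :
    ∃ Un : Subgroup Rˣ, ∀ u : Rˣ, u ∈ Un ↔ (u ∈ U ∧ (u : R) - 1 ∈ C) := by
  refine ⟨{ carrier := {u | u ∈ U ∧ (u : R) - 1 ∈ C}, mul_mem' := ?_, one_mem' := ?_, inv_mem' := ?_ }, fun u => Iff.rfl⟩
  · rintro u u' ⟨hu, huC⟩ ⟨hu', hu'C⟩
    refine ⟨U.mul_mem hu hu', ?_⟩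
    have h : ((u * u' : Rˣ) : R) - 1 = (u : R) * ((u' : R) - 1) + ((u : R) - 1) := by rw [Units.val_mul]; noncomm_ring
    rw [h]; exact C.add_mem (hUC u hu _ hu'C) huC
  · exact ⟨U.one_mem, by rw [Units.val_one, sub_self]; exact C.zero_mem⟩
  · rintro u ⟨hu, huC⟩
    refine ⟨U.inv_mem hu, ?_⟩
    have h : ((u⁻¹ : Rˣ) : R) - 1 = -(((u⁻¹ : Rˣ) : R) * ((u : R) - 1)) := by rw [mul_sub, Units.inv_mul, mul_one]; noncomm_ring
    rw [h]; exact C.neg_mem (hUC _ (U.inv_mem hu) _ huC)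

/-- **UNIT CLASSES AGAINST ADDITIVE CLASSES IN A RING** (★ `relIndex_add_relIndex_eq_of_units`, field version, re-run for any ring `R`): additive subgroups `C ≤ A′ ≤ A` of `R` with `[A : C]` finite;
a subgroup `U ≤ Rˣ` whose underlying set is EXACTLY `A ∖ A′`, with `u·C ⊆ C` for `u ∈ U`, and `U_C = {u ∈ U | u − 1 ∈ C}`.  Then `[U : U_C] + [A′ : A′ ∩ C] = [A : C]` (the additive class `u + C` of a unit
is the coset `u·U_C`, units meet exactly the classes not met by `A′`). [cite: Serre1979, Ch. IV §2 Prop. 6] -/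
theorem relIndex_add_relIndex_eq_of_units_ring (A A' C : AddSubgroup R) (hCA' : C ≤ A') (hA'A : A' ≤ A)
    (U Un : Subgroup Rˣ) (hU : ∀ x : R, (∃ u : Rˣ, u ∈ U ∧ (u : R) = x) ↔ (x ∈ A ∧ x ∉ A'))
    (hUn : ∀ u : Rˣ, u ∈ Un ↔ (u ∈ U ∧ (u : R) - 1 ∈ C))
    (hUC : ∀ u : Rˣ, u ∈ U → ∀ x : R, x ∈ C → (u : R) * x ∈ C) (hfin : C.relIndex A ≠ 0) :
    Un.relIndex U + C.relIndex A' = C.relIndex A := by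
  classical
  haveI : (C.addSubgroupOf A).FiniteIndex := ⟨hfin⟩
  haveI : Finite (A ⧸ C.addSubgroupOf A) := AddSubgroup.finite_quotient_of_finiteIndex
  have hmemA : ∀ u : Rˣ, u ∈ U → (u : R) ∈ A := fun u hu => ((hU u).1 ⟨u, hu, rfl⟩).1
  have hnotA' : ∀ u : Rˣ, u ∈ U → (u : R) ∉ A' := fun u hu => ((hU u).1 ⟨u, hu, rfl⟩).2
  let φ : U → A ⧸ C.addSubgroupOf A := fun u => QuotientAddGroup.mk ⟨(u : Rˣ), hmemA u u.2⟩
  let ι : A' →+ A := AddSubgroup.inclusion hA'A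
  have hι : ∀ x : A', x ∈ C.addSubgroupOf A' → ι x ∈ C.addSubgroupOf A := fun x hx => by
    rw [AddSubgroup.mem_addSubgroupOf] at hx ⊢; exact hx
  let θ := QuotientAddGroup.map (C.addSubgroupOf A') (C.addSubgroupOf A) ι hι
  have hθinj : Function.Injective θ := by
    rw [injective_iff_map_eq_zero]
    intro q hq
    induction q using QuotientAddGroup.induction_on with
    | H x =>
      rw [QuotientAddGroup.map_mk, QuotientAddGroup.eq_zero_iff, AddSubgroup.mem_addSubgroupOf] at hq
      rw [QuotientAddGroup.eq_zero_iff, AddSubgroup.mem_addSubgroupOf]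
      exact hq
  -- (1) `range φ = (range θ)ᶜ`
  have hrange : Set.range φ = (Set.range θ)ᶜ := by
    ext q
    constructor
    · rintro ⟨u, rfl⟩ ⟨q', hq'⟩
      induction q' using QuotientAddGroup.induction_on with
      | H x =>
        rw [QuotientAddGroup.map_mk] at hq'
        change (QuotientAddGroup.mk (ι x) : A ⧸ C.addSubgroupOf A) = QuotientAddGroup.mk ⟨(u : Rˣ), hmemA u u.2⟩ at hq'
        rw [QuotientAddGroup.eq, AddSubgroup.mem_addSubgroupOf] at hq'
        have hxA' : ((ι x : A) : R) ∈ A' := x.2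
        have hu : ((u : Rˣ) : R) ∈ A' := by
          have h := A'.add_mem hxA' (hCA' hq')
          simpa using h
        exact hnotA' u u.2 hu
    · intro hq
      induction q using QuotientAddGroup.induction_on with
      | H a =>
        have haA' : (a : R) ∉ A' := by
          intro ha
          exact hq ⟨QuotientAddGroup.mk ⟨a, ha⟩, by rw [QuotientAddGroup.map_mk]; rfl⟩
        obtain ⟨u, hu, hua⟩ := (hU a).2 ⟨a.2, haA'⟩
        refine ⟨⟨u, hu⟩, ?_⟩
        change (QuotientAddGroup.mk ⟨(u : R), hmemA u hu⟩ : A ⧸ C.addSubgroupOf A) = QuotientAddGroup.mk a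
        congr 1; exact Subtype.ext hua
  -- (2) `φ` descends to an injection of `U ⧸ U_C`
  have hφ : ∀ u u' : U, φ u = φ u' ↔ u⁻¹ * u' ∈ Un.subgroupOf U := by
    intro u u'
    rw [Subgroup.mem_subgroupOf, hUn]
    change (QuotientAddGroup.mk _ : A ⧸ C.addSubgroupOf A) = QuotientAddGroup.mk _ ↔ _
    rw [QuotientAddGroup.eq, AddSubgroup.mem_addSubgroupOf]
    change -((u : Rˣ) : R) + ((u' : Rˣ) : R) ∈ C ↔ _
    constructor
    · intro h
      refine ⟨Subgroup.mul_mem _ (Subgroup.inv_mem _ u.2) u'.2, ?_⟩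
      have h' := hUC _ (Subgroup.inv_mem _ u.2) _ h
      have e : (((u : Rˣ)⁻¹ : Rˣ) : R) * (-((u : Rˣ) : R) + ((u' : Rˣ) : R)) = (((u : Rˣ)⁻¹ * (u' : Rˣ) : Rˣ) : R) - 1 := by
        rw [Units.val_mul, mul_add, mul_neg, Units.inv_mul]; noncomm_ring
      have h'' : (((u : Rˣ)⁻¹ * (u' : Rˣ) : Rˣ) : R) - 1 ∈ C := by rw [← e]; exact h'
      simpa only [Subgroup.coe_mul, Subgroup.coe_inv] using h''
    · rintro ⟨-, h⟩
      have h0 : (((u : Rˣ)⁻¹ * (u' : Rˣ) : Rˣ) : R) - 1 ∈ C := by simpa only [Subgroup.coe_mul, Subgroup.coe_inv] using h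
      have h' := hUC _ u.2 _ h0
      have e : ((u : Rˣ) : R) * ((((u : Rˣ)⁻¹ * (u' : Rˣ) : Rˣ) : R) - 1) = -((u : Rˣ) : R) + ((u' : Rˣ) : R) := by
        rw [Units.val_mul, mul_sub, ← mul_assoc, Units.mul_inv, one_mul, mul_one]; noncomm_ring
      rw [← e]; exact h'
  let φbar : U ⧸ Un.subgroupOf U → Set.range φ :=
    Quotient.lift (fun u => (⟨φ u, u, rfl⟩ : Set.range φ)) (fun a b hab => by
      apply Subtype.ext
      change φ a = φ b
      rw [hφ]
      exact QuotientGroup.leftRel_apply.1 hab)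
  have hφbar : Function.Bijective φbar := by
    constructor
    · intro x y hxy
      induction x using Quotient.inductionOn with
      | h a =>
        induction y using Quotient.inductionOn with
        | h b =>
          have h : φ a = φ b := congrArg Subtype.val hxy
          exact Quotient.sound (QuotientGroup.leftRel_apply.2 ((hφ a b).1 h))
    · rintro ⟨_, u, rfl⟩
      exact ⟨Quotient.mk _ u, rfl⟩
  have hcardU : Nat.card (Set.range φ) = Un.relIndex U := by
    rw [Subgroup.relIndex, Subgroup.index_eq_card]
    exact (Nat.card_congr (Equiv.ofBijective φbar hφbar)).symm
  have hcardA' : Nat.card (Set.range θ) = C.relIndex A' := by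
    rw [AddSubgroup.relIndex, AddSubgroup.index_eq_card]
    exact Nat.card_range_of_injective hθinj
  have htot : (Set.range θ).ncard + (Set.range θ)ᶜ.ncard = Nat.card (A ⧸ C.addSubgroupOf A) := Set.ncard_add_ncard_compl _
  rw [← hrange, ← Nat.card_coe_set_eq, ← Nat.card_coe_set_eq, hcardA', hcardU, ← AddSubgroup.index_eq_card, add_comm] at htot
  exact htot

end Ring

/-! ## §2 The coordinate map `Φ(c, b) = q(c − b e₀, b)` and the boxes -/

section Datum

variable {K : Type} [Field K] [Valued K ℤᵐ⁰] {σ : K →+* K} {ϖ : K} {d t : ℕ}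

omit [Valued K ℤᵐ⁰] in
/-- **THE COORDINATE MAP** `Φ(c, b) = q(c − b e₀, b) = !![c − b e₀, ξ b; σ b, σ(c − b e₀)]` exists as an additive homomorphism `K × K →+ M₂(K)`. [cite: VignerasLNM800, Ch. II §1] -/
theorem exists_coordHom (σ : K →+* K) (ξ e₀ : K) :
    ∃ Φ : K × K →+ Matrix (Fin 2) (Fin 2) K, ∀ c b : K, Φ (c, b) = !![c - b * e₀, ξ * b; σ b, σ (c - b * e₀)] := by
  refine ⟨AddMonoidHom.mk' (fun p : K × K => !![p.1 - p.2 * e₀, ξ * p.2; σ p.2, σ (p.1 - p.2 * e₀)]) ?_, fun c b => rfl⟩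
  intro p p'
  ext i j
  fin_cases i <;> fin_cases j <;> simp [map_add, map_sub, map_mul] <;> ring

omit [Valued K ℤᵐ⁰] in
/-- `Φ` is injective (read the `σ b` and the `c − b e₀` entries). [cite: VignerasLNM800, Ch. II §1] -/
theorem coordHom_injective (hσ : ∀ x, σ (σ x) = x) {ξ e₀ : K} (Φ : K × K →+ Matrix (Fin 2) (Fin 2) K)
    (hΦ : ∀ c b : K, Φ (c, b) = !![c - b * e₀, ξ * b; σ b, σ (c - b * e₀)]) : Function.Injective Φ := by
  rw [injective_iff_map_eq_zero]
  rintro ⟨c, b⟩ h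
  rw [hΦ] at h
  have hb : σ b = 0 := by simpa using congrFun (congrFun h 1) 0
  have hb0 : b = 0 := by rw [← hσ b, hb, map_zero]
  have hc : c - b * e₀ = 0 := by simpa using congrFun (congrFun h 0) 0
  rw [hb0, zero_mul, sub_zero] at hc
  rw [hb0, hc]; rfl

/-- **MEMBERSHIP IN `Φ(Box n)`** (`Box n = B(exp n) × B(exp(n + d − 1))`): `M ∈ Φ(Box n) ⟺ M = q(a, b)` with `|N a − ξ N b| ≤ exp(2n)` — ★ FILE A both ways (`coords_of_v_norm_sub_mul_norm_le`,
`v_norm_sub_mul_norm_le_of_coords`).  So `Φ(Box 0) = 𝒪`, `Φ(Box(−n)) = 𝔓ⁿ`. [cite: VignerasLNM800, Ch. II §1] [cite: Serre1979, Ch. V §3] -/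
theorem mem_map_box_iff [CompleteSpace K] (hD : IsRamifiedQuadraticDatum σ ϖ d t)
    {ξ : K} (hσξ : σ ξ = ξ) (hξ1 : Valued.v ξ = 1) (hξN : ¬ ∃ z : K, z * σ z = ξ)
    {e₀ : K} (he₀1 : Valued.v e₀ ≤ 1) (he₀ : Valued.v (ξ - e₀ * σ e₀) ≤ exp (-(2 * ((d - 1 : ℕ) : ℤ))))
    (Φ : K × K →+ Matrix (Fin 2) (Fin 2) K) (hΦ : ∀ c b : K, Φ (c, b) = !![c - b * e₀, ξ * b; σ b, σ (c - b * e₀)]) (n : ℤ) (M : Matrix (Fin 2) (Fin 2) K) :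
    M ∈ (((Valued.v : Valuation K ℤᵐ⁰).leAddSubgroup (exp n)).prod ((Valued.v : Valuation K ℤᵐ⁰).leAddSubgroup (exp (n + ((d - 1 : ℕ) : ℤ))))).map Φ ↔
      ∃ a b : K, M = !![a, ξ * b; σ b, σ a] ∧ Valued.v (a * σ a - ξ * (b * σ b)) ≤ exp (2 * n) := by
  rw [AddSubgroup.mem_map]
  constructor
  · rintro ⟨⟨c, b⟩, hcb, rfl⟩
    rw [AddSubgroup.mem_prod, Valuation.mem_leAddSubgroup_iff, Valuation.mem_leAddSubgroup_iff] at hcb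
    exact ⟨c - b * e₀, b, hΦ c b, v_norm_sub_mul_norm_le_of_coords hD he₀1 he₀ hcb.1 hcb.2⟩
  · rintro ⟨a, b, rfl, h⟩
    obtain ⟨hb, hc⟩ := coords_of_v_norm_sub_mul_norm_le hD hσξ hξ1 hξN he₀ h
    refine ⟨(a + b * e₀, b), ?_, ?_⟩
    · rw [AddSubgroup.mem_prod, Valuation.mem_leAddSubgroup_iff, Valuation.mem_leAddSubgroup_iff]; exact ⟨hc, hb⟩
    · rw [hΦ, add_sub_cancel_right]

omit [Valued K ℤᵐ⁰] in
/-- Auxiliary: over integral `e₀`, `|b| ≤ 1 ⇒ (|a| ≤ 1 ⟺ |a + b e₀| ≤ 1)`. [cite: Serre1979, Ch. II §1] -/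
theorem v_add_mul_le_one_iff [Valued K ℤᵐ⁰] {e₀ a b : K} (he₀1 : Valued.v e₀ ≤ 1) (hb : Valued.v b ≤ 1) :
    Valued.v (a + b * e₀) ≤ 1 ↔ Valued.v a ≤ 1 := by
  have hbe : Valued.v (b * e₀) ≤ 1 := by rw [map_mul]; exact mul_le_one' hb he₀1
  constructor
  · intro h
    have : a = (a + b * e₀) - b * e₀ := by ring
    rw [this]; exact (Valuation.map_sub _ _ _).trans (max_le h hbe)
  · intro h; exact (Valuation.map_add _ _ _).trans (max_le h hbe)

/-- **MEMBERSHIP IN `Φ(B(exp m) × B(1))`, `m ≤ 0`** (the `Λ`-side boxes: `Λ = Φ(B(1) × B(1))`, `Λ ∩ 𝔓 = Φ(B(exp(−1)) × B(1))`, `𝔓^{d−1} = Φ(B(exp(−(d−1))) × B(1))`): `M ∈ Φ(B(exp m) × B(1)) ⟺ M = q(a,b)`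
with `|b| ≤ 1` and `|a + b e₀| ≤ exp m`; for `m = 0` this is `a, b ∈ 𝒪_E`. [cite: VignerasLNM800, Ch. II §1] -/
theorem mem_map_intBox_iff {ξ e₀ : K} (Φ : K × K →+ Matrix (Fin 2) (Fin 2) K) (hΦ : ∀ c b : K, Φ (c, b) = !![c - b * e₀, ξ * b; σ b, σ (c - b * e₀)])
    (m : ℤ) (M : Matrix (Fin 2) (Fin 2) K) :
    M ∈ (((Valued.v : Valuation K ℤᵐ⁰).leAddSubgroup (exp m)).prod ((Valued.v : Valuation K ℤᵐ⁰).leAddSubgroup (exp 0))).map Φ ↔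
      ∃ a b : K, M = !![a, ξ * b; σ b, σ a] ∧ Valued.v (a + b * e₀) ≤ exp m ∧ Valued.v b ≤ 1 := by
  rw [AddSubgroup.mem_map]
  constructor
  · rintro ⟨⟨c, b⟩, hcb, rfl⟩
    rw [AddSubgroup.mem_prod, Valuation.mem_leAddSubgroup_iff, Valuation.mem_leAddSubgroup_iff, exp_zero] at hcb
    exact ⟨c - b * e₀, b, hΦ c b, by rw [sub_add_cancel]; exact hcb.1, hcb.2⟩
  · rintro ⟨a, b, rfl, hc, hb⟩
    refine ⟨(a + b * e₀, b), ?_, by rw [hΦ, add_sub_cancel_right]⟩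
    rw [AddSubgroup.mem_prod, Valuation.mem_leAddSubgroup_iff, Valuation.mem_leAddSubgroup_iff, exp_zero]; exact ⟨hc, hb⟩

/-- **INDICES OF THE BOXES** (`Φ` injective, ★ `relIndex_eq_mul_of_map_eq_prod`, ★ `relIndex_leAddSubgroup_exp`): `[Φ(B(exp a₁) × B(exp a₂)) : Φ(B(exp b₁) × B(exp b₂))] = q^{a₁−b₁}·q^{a₂−b₂}`
for `b₁ ≤ a₁`, `b₂ ≤ a₂`. [cite: Serre1979, Ch. II §3 Prop. 5] -/
theorem relIndex_map_box [Finite 𝓀[K]] (hσ : ∀ x, σ (σ x) = x) (hϖ : Valued.v ϖ = exp (-1 : ℤ)) {ξ e₀ : K}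
    (Φ : K × K →+ Matrix (Fin 2) (Fin 2) K) (hΦ : ∀ c b : K, Φ (c, b) = !![c - b * e₀, ξ * b; σ b, σ (c - b * e₀)]) (a₁ a₂ b₁ b₂ : ℤ) :
    ((((Valued.v : Valuation K ℤᵐ⁰).leAddSubgroup (exp b₁)).prod ((Valued.v : Valuation K ℤᵐ⁰).leAddSubgroup (exp b₂))).map Φ).relIndex
        ((((Valued.v : Valuation K ℤᵐ⁰).leAddSubgroup (exp a₁)).prod ((Valued.v : Valuation K ℤᵐ⁰).leAddSubgroup (exp a₂))).map Φ) =
      Nat.card 𝓀[K] ^ (a₁ - b₁).toNat * Nat.card 𝓀[K] ^ (a₂ - b₂).toNat := by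
  rw [AddSubgroup.relIndex_map_map_of_injective _ _ (coordHom_injective hσ Φ hΦ),
    Summit.HodgeConjecture.HodgeConjecture.Cruxes.H413.K2E5BetaLieVolFactorization.relIndex_prod_prod,
    relIndex_leAddSubgroup_exp hϖ, relIndex_leAddSubgroup_exp hϖ]

end Datum

end Summit.HodgeConjecture.HodgeConjecture.Cruxes.H413.K2E3WildQuaternionUnitClasses

end
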